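import Summits.NavierStokesRegularity.NavierStokesRegularity.Theorems.ArgmaxDoorsGrowth
import Summits.NavierStokesRegularity.NavierStokesRegularity.Theorems.ArgmaxDoorsAlmostArgmax
import Literature.Analysis.FluidPDE.LerayProfileCalculus
import Literature.Analysis.FluidPDE.RadialCalculus
import Literature.Analysis.FluidPDE.SteadyLiouvilleTsaiKit
import HarnessLib

/-!
# ArgmaxDoorsPenalisedGrowth — S35 «ArgmaxDoors»: E1 at a PENALISED vorticity maximum and the argmax
# engine for BOUNDED classical solutions (no decay, no Sobolev class; companion of `ArgmaxDoorsAlmostArgmax`)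

For bounded, non-decaying fields the vorticity maximum need not be attained; `ArgmaxDoorsAlmostArgmax`
penalises with `(1 + ε|x|²)⁻¹` and asks for the growth bound at penalised maximisers, up to an allowance
`η(ε) → 0`. This file supplies that bound for the vorticity of a classical solution with bounded velocity
(the twist credit survives; the weight costs `3νε + U√ε/2`, UNIFORMLY in the position of the maximiser — the
point of the rational weight: `|∇w/w| ≤ √ε`, `|Δw/w| ≤ 8ε`), and the slab composition.

* `sq_norm_mul_frobeniusNormSq_vorticityDirection_le` — `|ω|²|∇ξ|²_F ≤ |∇ω|²_F`;
* `inner_vorticity_rhs_le_at_penalisedArgmax` (E1-penalised) — at a global maximiser `x̄` of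
  `(1 + ε|x|²)⁻¹|ω|²` with `ω(x̄) ≠ 0`, `|v(x̄)| ≤ U`:
  `⟪ω(x̄), w⟫ ≤ (α − ν|∇ξ|²_F + 3νε + U√ε/2)(x̄)·|ω(x̄)|²` for any `w` solving the vorticity equation at `x̄`
  (`∇(pP) = 0` ⇒ `⟪ω,∇ω h⟫ = (ε/(1+ε|x̄|²))|ω|²⟪x̄,h⟫`; `Δ(pP) ≤ 0` + radial calculus ⇒
  `Δ|ω|²(x̄) ≤ 6ε|ω|²` — the `|x̄|²`-terms cancel; `⟪ω,Δω⟫ = ½Δ|ω|² − |∇ω|²_F`);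
* `norm_curl_le_mul_exp_of_almostArgmax_rate_le` — on `[0,T''] × ℝ³`, classical solution with `|u| ≤ U`,
  `|ω| ≤ K`: «`α − ν|∇ξ|²_F ≤ φ(t)` at every `(1−δ)`-almost argmax of `|ω(t,·)|`» ⇒
  `sup|ω(t)| ≤ sup|ω(0)|·e^{Φ(t)−Φ(0)}` — the form needed for bounded ancient (Liouville-class) profiles
  (nsreg-p1 g29 seed σ1 «ancient argmax law»).

HONEST FRAME / WHAT THIS IS NOT: tools for regularity / Liouville CRITERIA (S-door lane, LEAD ns-s30-p1 g3,
`--supports stmt-NavierStokesRegularity-0056 --as helper`); item 0056 `NoTypeII`, the wall cruxes and NS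
regularity are NOT proved; no Literature fact is taken as a hypothesis; nothing here is a route or a summit
statement. [cite: GalantiGibbonHeritage1997, §3 (Dw1), (Dw4); folklore (Omori–Yau maximum principle)]
-/

noncomputable section

set_option linter.dupNamespace false

open MeasureTheory Set Function Filter Metric Real InnerProductSpace
open _root_.Topology
open scoped ENNReal NNReal RealInnerProductSpace ContDiff Laplacian
open Literature.Analysis Literature.Analysis.FluidPDE
open Literature.Analysis.FluidPDE.VorticityDirectionDynamics

namespace Summit.NavierStokesRegularity.NavierStokesRegularity.Theorems.ArgmaxDoors

-- nested operator types (second derivatives)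
set_option maxSynthPendingDepth 3

/-- `|ω|²|∇ξ|²_F ≤ |∇ω|²_F` (`ξ = ω/|ω|`): the direction gradient is the tangential part of `∇ω/|ω|`.
[folklore] -/
theorem sq_norm_mul_frobeniusNormSq_vorticityDirection_le
    {W : EuclideanSpace ℝ (Fin 3) → EuclideanSpace ℝ (Fin 3)} {x : EuclideanSpace ℝ (Fin 3)}
    (h : DifferentiableAt ℝ W x) (hx : W x ≠ 0) :
    ‖W x‖ ^ 2 * frobeniusNormSq (fderiv ℝ (vorticityDirection W) x) ≤
      frobeniusNormSq (fderiv ℝ W x) := by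
  set b := stdOrthonormalBasis ℝ (EuclideanSpace ℝ (Fin 3))
  rw [frobeniusNormSq_eq_sum b, frobeniusNormSq_eq_sum b, Finset.mul_sum]
  refine Finset.sum_le_sum fun i _ => ?_
  have hr : 0 < ‖W x‖ := norm_pos_iff.2 hx
  have hid := norm_mul_norm_sq_fderiv_vorticityDirection_apply h hx (b i)
  -- `‖ω‖² ‖Dξ e‖² = ‖ω‖ · (‖ω‖‖Dξ e‖²) = (‖Dω e‖²‖ω‖² − ⟪ω,Dω e⟫²)/‖ω‖² ≤ ‖Dω e‖²`
  have h1 : ‖W x‖ ^ 2 * ‖fderiv ℝ (vorticityDirection W) x (b i)‖ ^ 2 =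
      (‖fderiv ℝ W x (b i)‖ ^ 2 * ‖W x‖ ^ 2 - ⟪W x, fderiv ℝ W x (b i)⟫ ^ 2) / ‖W x‖ ^ 2 := by
    have : ‖W x‖ ^ 2 * ‖fderiv ℝ (vorticityDirection W) x (b i)‖ ^ 2 =
        ‖W x‖ * (‖W x‖ * ‖fderiv ℝ (vorticityDirection W) x (b i)‖ ^ 2) := by ring
    rw [this, hid]
    field_simp
  rw [h1, div_le_iff₀ (by positivity)]
  nlinarith [sq_nonneg ⟪W x, fderiv ℝ W x (b i)⟫]

set_option maxHeartbeats 800000 in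
-- one long pointwise computation (penalised first/second-order conditions + the vorticity identity)
/-- **E1-penalised «ArgmaxGrowth at a penalised maximum».** Let `v ∈ C^∞(ℝ³;ℝ³)`, `ω = curl v`,
`ε > 0`, `ν ≥ 0`, and let `x̄` maximise `x ↦ (1 + ε|x|²)⁻¹|ω(x)|²` globally with `ω(x̄) ≠ 0`,
`|v(x̄)| ≤ U`. If `w` satisfies the vorticity equation at `x̄`, `w + (v·∇)ω = (ω·∇)v + νΔω`, then
`⟪ω(x̄), w⟫ ≤ (α(x̄) − ν|∇ξ(x̄)|²_F + (3νε + U√ε/2))·|ω(x̄)|²`, `α = ⟪ξ, ∇v ξ⟫`, `ξ = ω/|ω|`.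
Proof: with `p = (1 + ε|x|²)⁻¹`, `P = |ω|²`: `∇(pP)(x̄) = 0` gives `⟪ω, ∇ω·h⟫ = (ε/(1+ε|x̄|²))|ω|²⟪x̄,h⟫`
(so the transport term is `≤ (U√ε/2)|ω|²`, as `ε|x̄|/(1+ε|x̄|²) ≤ √ε/2`), and `Δ(pP)(x̄) ≤ 0` with the
radial formulas for `∇p, Δp` gives `ΔP(x̄) ≤ 6ε|ω|²/(1+ε|x̄|²)` (the `|x̄|²`-terms cancel exactly); then
`⟪ω,Δω⟫ = ½ΔP − |∇ω|²_F ≤ 3ε|ω|² − |ω|²|∇ξ|²_F`. [folklore; cf. Omori–Yau] -/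
theorem inner_vorticity_rhs_le_at_penalisedArgmax {ν ε U : ℝ} (hν : 0 ≤ ν) (hε : 0 < ε)
    {v : (EuclideanSpace ℝ (Fin 3)) → (EuclideanSpace ℝ (Fin 3))} (hv : ContDiff ℝ ∞ v)
    {x₀ : EuclideanSpace ℝ (Fin 3)} (hvU : ‖v x₀‖ ≤ U)
    (hmax : ∀ x, (1 + ε * ‖x‖ ^ 2)⁻¹ * ‖curl v x‖ ^ 2 ≤ (1 + ε * ‖x₀‖ ^ 2)⁻¹ * ‖curl v x₀‖ ^ 2)
    (hne : curl v x₀ ≠ 0) {w : EuclideanSpace ℝ (Fin 3)}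
    (hw : w + convect v (curl v) x₀ = convect (curl v) v x₀ + ν • (Δ (curl v)) x₀) :
    ⟪curl v x₀, w⟫ ≤
      (⟪vorticityDirection (curl v) x₀, fderiv ℝ v x₀ (vorticityDirection (curl v) x₀)⟫ -
          ν * frobeniusNormSq (fderiv ℝ (vorticityDirection (curl v)) x₀) +
          (3 * ν * ε + U * Real.sqrt ε / 2)) * ‖curl v x₀‖ ^ 2 := by
  have hU : 0 ≤ U := (norm_nonneg _).trans hvU
  set om : (EuclideanSpace ℝ (Fin 3)) → (EuclideanSpace ℝ (Fin 3)) := curl v with homdef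
  have hom : ContDiff ℝ ∞ om :=
    contDiff_curl (n := ⊤) (hv.of_le (by exact_mod_cast (le_top : (⊤ + 1 : ℕ∞) ≤ ⊤)))
  have homC2 : ContDiff ℝ 2 om := contDiff_infty.mp hom 2
  have homd : DifferentiableAt ℝ om x₀ := homC2.differentiable (by norm_num) x₀
  set ρ : ℝ := ‖om x₀‖ with hρdef
  have hρ : 0 < ρ := norm_pos_iff.2 hne
  set ξ := vorticityDirection om x₀ with hξdef
  -- ### the weight `p`, the square `P`, the penalised function `f = p P`
  set r2 : ℝ := ‖x₀‖ ^ 2 with hr2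
  set D : ℝ := 1 + ε * r2 with hD
  have hDpos : 0 < D := by rw [hD]; positivity
  have hD1 : 1 ≤ D := by rw [hD]; nlinarith [sq_nonneg ‖x₀‖, hε.le]
  set g : ℝ → ℝ := fun s => (1 + ε * s)⁻¹ with hg
  set g₁ : ℝ → ℝ := fun s => -ε / (1 + ε * s) ^ 2 with hg₁
  set Uσ : Set ℝ := {s : ℝ | 0 < 1 + ε * s} with hUσ
  have hUo : IsOpen Uσ := isOpen_lt continuous_const (continuous_const.add (continuous_const.mul continuous_id))
  have hgd : ∀ s ∈ Uσ, HasDerivAt g (g₁ s) s := by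
    intro s hs
    have h1 : HasDerivAt (fun s : ℝ => 1 + ε * s) ε s := by
      simpa using ((hasDerivAt_id s).const_mul ε).const_add 1
    exact h1.inv (ne_of_gt hs)
  have hr2U : r2 ∈ Uσ := hDpos
  have hg₁d : HasDerivAt g₁ (2 * ε ^ 2 / D ^ 3) r2 := by
    -- `g₁ = −ε g²`, so `g₁' = −2ε g g₁ = 2ε²/D³`
    have h := ((hgd r2 hr2U).pow 2).const_mul (-ε)
    have hfun : (fun s : ℝ => -ε * (g ^ 2) s) = g₁ := by
      funext s
      simp only [Pi.pow_apply, hg, hg₁, inv_pow, div_eq_mul_inv, neg_mul]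
    rw [hfun] at h
    refine h.congr_deriv ?_
    have hgr : g r2 = D⁻¹ := rfl
    have hg1r : g₁ r2 = -ε / D ^ 2 := rfl
    rw [hgr, hg1r]
    norm_num
    field_simp
  set p : (EuclideanSpace ℝ (Fin 3)) → ℝ := fun y => g (‖y‖ ^ 2) with hp
  have hp_eq : ∀ y, p y = (1 + ε * ‖y‖ ^ 2)⁻¹ := fun y => rfl
  have hpx : p x₀ = D⁻¹ := rfl
  have hp2 : ContDiff ℝ 2 p := by
    have h1 : ContDiff ℝ 2 fun y : EuclideanSpace ℝ (Fin 3) => 1 + ε * ‖y‖ ^ 2 :=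
      contDiff_const.add (contDiff_const.mul (contDiff_norm_sq ℝ))
    exact h1.inv fun y => by positivity
  have hDp : ∀ h, fderiv ℝ p x₀ h = 2 * g₁ r2 * ⟪x₀, h⟫ := fun h =>
    fderiv_comp_norm_sq_apply (hgd r2 hr2U) h
  have hΔp : (Δ p) x₀ = 4 * (2 * ε ^ 2 / D ^ 3) * r2 + 2 * 3 * g₁ r2 := by
    have h := laplacian_comp_norm_sq hUo hgd hr2U hg₁d
    rw [finrank_euclideanSpace_fin] at h
    push_cast at h
    exact h
  set P : (EuclideanSpace ℝ (Fin 3)) → ℝ := fun y => ⟪om y, om y⟫ with hP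
  have hP2 : ContDiff ℝ 2 P := homC2.inner ℝ homC2
  have hPx : P x₀ = ρ ^ 2 := real_inner_self_eq_norm_sq _
  have hDP : ∀ h, fderiv ℝ P x₀ h = 2 * ⟪om x₀, fderiv ℝ om x₀ h⟫ := by
    intro h
    have hd : HasFDerivAt P _ x₀ := homd.hasFDerivAt.inner ℝ homd.hasFDerivAt
    rw [hd.fderiv]
    simp only [ContinuousLinearMap.comp_apply, fderivInnerCLM_apply, ContinuousLinearMap.prod_apply]
    rw [real_inner_comm (om x₀)]
    ring
  set f : (EuclideanSpace ℝ (Fin 3)) → ℝ := fun y => p y * P y with hf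
  have hf2 : ContDiff ℝ 2 f := hp2.mul hP2
  have hfmax : IsLocalMax f x₀ := Filter.Eventually.of_forall fun y => by
    simp only [hf, hp_eq, hP, real_inner_self_eq_norm_sq]
    exact hmax y
  -- ### first order: `⟪ω, ∇ω h⟫ = κ₁ ρ² ⟪x₀, h⟫`, `κ₁ = ε/D`
  have hfd : HasFDerivAt f (p x₀ • fderiv ℝ P x₀ + P x₀ • fderiv ℝ p x₀) x₀ :=
    ((hp2.differentiable (by norm_num) x₀).hasFDerivAt.mul
      ((hP2.differentiable (by norm_num) x₀).hasFDerivAt))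
  have hzero := hfmax.hasFDerivAt_eq_zero hfd
  have hfirst : ∀ h, ⟪om x₀, fderiv ℝ om x₀ h⟫ = ε / D * ρ ^ 2 * ⟪x₀, h⟫ := by
    intro h
    have h0 : p x₀ * fderiv ℝ P x₀ h + P x₀ * fderiv ℝ p x₀ h = 0 := by
      simpa using congrArg (fun L : (EuclideanSpace ℝ (Fin 3)) →L[ℝ] ℝ => L h) hzero
    rw [hDP h, hDp h, hpx, hPx] at h0
    -- `D⁻¹ · 2⟪ω,∇ω h⟫ + ρ² · 2 g₁ ⟪x₀,h⟫ = 0`, `g₁ = −ε/D²`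
    have hg₁v : g₁ r2 = -ε / D ^ 2 := rfl
    rw [hg₁v] at h0
    field_simp at h0
    field_simp
    linear_combination h0 / 2
  -- ### second order: `ΔP(x₀) ≤ 6ε ρ²`
  have hΔf : (Δ f) x₀ ≤ 0 := hfmax.laplacian_nonpos hf2
  have hprod := Tsai2021.laplacian_mul_eq (χ := p) (f := P) hp2 hP2 x₀
  have hcross : ∑ i : Fin 3, fderiv ℝ p x₀ (EuclideanSpace.single i (1 : ℝ)) *
      fderiv ℝ P x₀ (EuclideanSpace.single i (1 : ℝ)) = 4 * g₁ r2 * (ε / D * ρ ^ 2) * r2 := by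
    have hterm : ∀ i : Fin 3, fderiv ℝ p x₀ (EuclideanSpace.single i (1 : ℝ)) *
        fderiv ℝ P x₀ (EuclideanSpace.single i (1 : ℝ)) =
        4 * g₁ r2 * (ε / D * ρ ^ 2) * ⟪x₀, EuclideanSpace.single i (1 : ℝ)⟫ ^ 2 := by
      intro i
      simp only [hDp, hDP, hfirst]; ring
    simp_rw [hterm]
    rw [← Finset.mul_sum]
    congr 1
    have hb := (EuclideanSpace.basisFun (Fin 3) ℝ).sum_inner_mul_inner x₀ x₀
    rw [real_inner_self_eq_norm_sq] at hb
    rw [hr2, ← hb]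
    refine Finset.sum_congr rfl fun i _ => ?_
    rw [sq, EuclideanSpace.basisFun_apply, real_inner_comm x₀]
  have hΔP : (Δ P) x₀ ≤ 6 * ε * ρ ^ 2 := by
    have h := hΔf
    have hfp : (Δ f) x₀ = (Δ (fun y => p y * P y)) x₀ := rfl
    rw [hfp, hprod, hcross, hΔp, hpx, hPx] at h
    have hg₁v : g₁ r2 = -ε / D ^ 2 := rfl
    rw [hg₁v] at h
    -- `h : D⁻¹ ΔP + 2·(4(−ε/D²)(ε/D)ρ² r2) + ρ²(4(2ε²/D³) r2 + 6(−ε/D²)) ≤ 0`; the `r2`-terms cancel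
    have hsum : 2 * (4 * (-ε / D ^ 2) * (ε / D * ρ ^ 2) * r2) +
        ρ ^ 2 * (4 * (2 * ε ^ 2 / D ^ 3) * r2 + 2 * 3 * (-ε / D ^ 2)) = -(6 * ε * ρ ^ 2 / D ^ 2) := by
      field_simp
      ring
    have h2 : D⁻¹ * (Δ P) x₀ ≤ 6 * ε * ρ ^ 2 / D ^ 2 := by
      rw [add_assoc, hsum] at h
      linarith
    have h3 : (Δ P) x₀ ≤ D * (6 * ε * ρ ^ 2 / D ^ 2) := by rwa [inv_mul_le_iff₀ hDpos] at h2
    have h4 : D * (6 * ε * ρ ^ 2 / D ^ 2) = 6 * ε * ρ ^ 2 / D := by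
      field_simp
    rw [h4] at h3
    exact h3.trans (div_le_self (by positivity) hD1)
  -- ### the three terms of the vorticity identity
  have heq : w = convect om v x₀ + ν • (Δ om) x₀ - convect v om x₀ := eq_sub_of_add_eq hw
  -- (a) stretching
  have ha : ⟪om x₀, convect om v x₀⟫ = ⟪ξ, fderiv ℝ v x₀ ξ⟫ * ρ ^ 2 := by
    rw [convect_apply]
    have h1 : om x₀ = ρ • ξ := by rw [hξdef, hρdef, norm_smul_vorticityDirection]
    conv_lhs => rw [h1]
    rw [map_smul, inner_smul_left, inner_smul_right]
    simp only [conj_trivial]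
    ring
  -- (b) transport, with the penalisation error
  have hb : |⟪om x₀, convect v om x₀⟫| ≤ U * Real.sqrt ε / 2 * ρ ^ 2 := by
    rw [convect_apply, hfirst]
    have hxv : |⟪x₀, v x₀⟫| ≤ ‖x₀‖ * U := (abs_real_inner_le_norm _ _).trans
      (mul_le_mul_of_nonneg_left hvU (norm_nonneg _))
    have hrat : ε / D * ‖x₀‖ ≤ Real.sqrt ε / 2 := by
      -- `2 ε |x₀| ≤ √ε (1 + ε|x₀|²)` iff `0 ≤ (1 − √ε|x₀|)²`
      rw [div_mul_eq_mul_div, div_le_div_iff₀ hDpos (by norm_num : (0:ℝ) < 2)]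
      have hs : Real.sqrt ε * Real.sqrt ε = ε := Real.mul_self_sqrt hε.le
      have hs0 : 0 ≤ Real.sqrt ε := Real.sqrt_nonneg ε
      have fact1 : 0 ≤ Real.sqrt ε * (1 - Real.sqrt ε * ‖x₀‖) ^ 2 := mul_nonneg hs0 (sq_nonneg _)
      have fact3 : Real.sqrt ε * Real.sqrt ε * ‖x₀‖ = ε * ‖x₀‖ := by rw [hs]
      have fact4 : Real.sqrt ε * (Real.sqrt ε * Real.sqrt ε) * ‖x₀‖ ^ 2 =
          Real.sqrt ε * ε * ‖x₀‖ ^ 2 := by rw [hs]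
      have hDe : D = 1 + ε * ‖x₀‖ ^ 2 := by rw [hD, hr2]
      rw [hDe]
      nlinarith [fact1, fact3, fact4]
    rw [abs_mul, abs_mul, abs_of_pos (div_pos hε hDpos), abs_of_pos (pow_pos hρ 2)]
    calc ε / D * ρ ^ 2 * |⟪x₀, v x₀⟫| ≤ ε / D * ρ ^ 2 * (‖x₀‖ * U) :=
          mul_le_mul_of_nonneg_left hxv (by positivity)
      _ = (ε / D * ‖x₀‖) * U * ρ ^ 2 := by ring
      _ ≤ (Real.sqrt ε / 2) * U * ρ ^ 2 :=
          mul_le_mul_of_nonneg_right (mul_le_mul_of_nonneg_right hrat hU) (sq_nonneg _)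
      _ = U * Real.sqrt ε / 2 * ρ ^ 2 := by ring
  -- (c) diffusion with the twist credit and the penalisation error
  have hc : ⟪om x₀, (Δ om) x₀⟫ ≤
      3 * ε * ρ ^ 2 - ρ ^ 2 * frobeniusNormSq (fderiv ℝ (vorticityDirection om) x₀) := by
    have hid := laplacian_inner_self_eq homC2 x₀
    have hΔPid : (Δ P) x₀ = 2 * ⟪(Δ om) x₀, om x₀⟫ + 2 * frobeniusNormSq (fderiv ℝ om x₀) := hid
    have htw := sq_norm_mul_frobeniusNormSq_vorticityDirection_le homd hne
    rw [real_inner_comm]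
    rw [← hρdef] at htw
    linarith [hΔP, hΔPid, htw]
  -- ### assemble
  rw [heq, inner_sub_right, inner_add_right, inner_smul_right, ha]
  have hνc := mul_le_mul_of_nonneg_left hc hν
  have hb' := (neg_le_abs _).trans hb   -- `-⟪ω,(v·∇)ω⟫ ≤ |…|`
  rw [hρdef] at hνc hb' ⊢
  nlinarith [hνc, hb', abs_nonneg ⟪om x₀, convect v om x₀⟫]


/-- **The argmax engine for BOUNDED classical solutions (no decay, no Sobolev class).** On a closed slab
`[0,T''] × ℝ³` let `(u,p)` be a classical unforced Navier–Stokes solution (`ν > 0`) with `|u| ≤ U` and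
`|ω| ≤ K` bounded (e.g. a bounded ancient solution with bounded vorticity); let `Φ` be continuous with
one-sided derivative `φ`, and `0 < δ`. If at every `t ∈ (0,T'']` and every `(1−δ)`-ALMOST ARGMAX `x̄` of
`|ω(t,·)|` (`(1−δ)|ω(t,x)| ≤ |ω(t,x̄)|` for all `x`) with `ω(t,x̄) ≠ 0` the twist-credited rate obeys
`α(t,x̄) − ν|∇ξ(t,x̄)|²_F ≤ φ(t)`, then `sup|ω(t)| ≤ sup|ω(0)|·e^{Φ(t)−Φ(0)}`. (E1-penalised +
`norm_le_mul_exp_of_almostArgmax_inner_timeDeriv_le`, penalisation error `3νε + U√ε/2 → 0`.) [folklore] -/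
theorem norm_curl_le_mul_exp_of_almostArgmax_rate_le {ν T'' U K δ : ℝ} (hν : 0 < ν) (hT'' : 0 < T'')
    (hδ : 0 < δ) {u : ℝ → (EuclideanSpace ℝ (Fin 3)) → (EuclideanSpace ℝ (Fin 3))}
    {p : ℝ → (EuclideanSpace ℝ (Fin 3)) → ℝ} (hS : IsClassicalNSSolutionOn (Icc 0 T'') ν 0 u p)
    (hUb : ∀ t ∈ Icc 0 T'', ∀ x, ‖u t x‖ ≤ U) (hKb : ∀ t ∈ Icc 0 T'', ∀ x, ‖curl (u t) x‖ ≤ K)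
    {Φ φ : ℝ → ℝ} (hΦc : ContinuousOn Φ (Icc 0 T''))
    (hΦ : ∀ t ∈ Icc 0 T'', HasDerivWithinAt Φ (φ t) (Icc 0 T'') t)
    (hrate : ∀ t ∈ Icc 0 T'', 0 < t → ∀ x₀ : EuclideanSpace ℝ (Fin 3),
      (∀ x, (1 - δ) * ‖curl (u t) x‖ ≤ ‖curl (u t) x₀‖) → curl (u t) x₀ ≠ 0 →
      ⟪vorticityDirection (curl (u t)) x₀, fderiv ℝ (u t) x₀ (vorticityDirection (curl (u t)) x₀)⟫ -
          ν * frobeniusNormSq (fderiv ℝ (vorticityDirection (curl (u t))) x₀) ≤ φ t)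
    {M : ℝ} (hM : ∀ x, ‖curl (u 0) x‖ ≤ M) :
    ∀ t ∈ Icc 0 T'', ∀ x, ‖curl (u t) x‖ ≤ M * Real.exp (Φ t - Φ 0) := by
  have hU : UniqueDiffOn ℝ (Icc 0 T'') := uniqueDiffOn_Icc hT''
  have hωsm : IsSmoothSpaceTimeOn (Icc 0 T'') (vorticity u) :=
    (hS.smooth_velocity.fderiv_slice hU).clm_comp curlCLM
  have hvort : ∀ t ∈ Icc 0 T'', ∀ x,
      timeDerivWithin (Icc 0 T'') (vorticity u) t x + convect (u t) (vorticity u t) x =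
        convect (vorticity u t) (u t) x + ν • (Δ (vorticity u t)) x :=
    fun t ht x =>
    (hS.isVorticitySolutionOn_of_uniqueDiffOn hU (fun s _ y => curl_zero y)).vorticity_eq t ht x
  -- the penalisation error
  set η : ℝ → ℝ := fun ε => 3 * ν * ε + U * Real.sqrt ε / 2 with hη
  have hηt : Tendsto η (𝓝[>] 0) (𝓝 0) := by
    have hc : Continuous η := by rw [hη]; fun_prop
    have h0 : η 0 = 0 := by simp [hη]
    have h := hc.tendsto 0
    rw [h0] at h
    exact h.mono_left nhdsWithin_le_nhds
  have hgrow : ∀ ε : ℝ, 0 < ε → ε ≤ 1 → ∀ t ∈ Icc 0 T'', 0 < t → ∀ x₀ : EuclideanSpace ℝ (Fin 3),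
      (∀ x, (1 + ε * ‖x‖ ^ 2)⁻¹ * ‖vorticity u t x‖ ^ 2 ≤
        (1 + ε * ‖x₀‖ ^ 2)⁻¹ * ‖vorticity u t x₀‖ ^ 2) →
      (∀ x, (1 - δ) * ‖vorticity u t x‖ ≤ ‖vorticity u t x₀‖) → vorticity u t x₀ ≠ 0 →
      ⟪vorticity u t x₀, timeDerivWithin (Icc 0 T'') (vorticity u) t x₀⟫ ≤
        (φ t + η ε) * ‖vorticity u t x₀‖ ^ 2 := by
    intro ε hε _ t ht htpos x₀ hpen halmost hne
    have hv : ContDiff ℝ ∞ (u t) := hS.contDiff_velocity ht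
    have h1 := inner_vorticity_rhs_le_at_penalisedArgmax hν.le hε hv (hUb t ht x₀) hpen hne
      (hvort t ht x₀)
    have h2 := hrate t ht htpos x₀ halmost hne
    refine h1.trans (mul_le_mul_of_nonneg_right ?_ (sq_nonneg _))
    simp only [hη]
    linarith
  exact norm_le_mul_exp_of_almostArgmax_inner_timeDeriv_le hωsm ⟨K, hKb⟩ hΦc hΦ hδ hηt hgrow hM

end Summit.NavierStokesRegularity.NavierStokesRegularity.Theorems.ArgmaxDoors

end
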